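import Summits.QuantumFields.YangMills.Theorems.BalabanUVNodesN07ChartD2Remainder
import HarnessLib

/-!
# BalabanUVNodes ∕ N07 — `D₃ := D − D^{(2)}` IS CUBIC AT NODE 00's RECORD, with the second-order part `D^{(2)}(A′) = ½D²D(0)(A′, A′)` IDENTIFIED: [15] p. 286 «a power series
# expansion of D(A′) begins with second order terms» and p. 290 (78)∕(80) `⟨HD(A′), J⟩ = ⟨HC^{(2)}(A′), J⟩ + ⟨HD₃(A′), J⟩` — the cubic bound on `D₃` the print uses and does not state

Cell `pub-ymgap`, width seat `pub-ymgap-dag-n07-w2` generation 5 (HUMAN RULING D-0149; DAG node N07 = [15] = [Balaban1985Variational]; W-SEAT START LIST §n07 item 2 = S2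
«[15] Sect. C (47)–(49), Prop. 3 at objects» — the object `D` of Prop. 3 and its Taylor parts).  `--kind proof --supports stmt-QuantumFields-27364 --as helper` (K1⁹ face per KEY
MAP v2; count-neutral).  CONSUMED BY NAME, nothing modified: lit-balaban r08's `B11SchwarzRemainder.{leadCoeff, norm_leadCoeff_le_of_pow_bound, norm_sub_leadCoeff_le_of_pow_bound_two}`
(the order-`n` Schwarz lemma on a slice; its `reading_D3` is the abstract reading with the coefficient `a₂` left as a hook — DISCHARGED here for analytic `Φ`); Mathlib's
`DifferentiableOn.analyticAt`, `HasFPowerSeriesAt.has_fpower_series_iterate_dslope_fslope`, `FormalMultilinearSeries.coeff_fslope`, `HasFPowerSeriesOnBall.factorial_smul`,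
`iteratedDeriv_eq_iteratedFDeriv`; this seat's `N07ChartD2Remainder.{hasDerivAt_slice_fderiv_zero, exists_chartD2_T4}` (the 𝔇₂ package at the record).

THE PRINT.  p. 286 [PDF 10]: «|D(A′)| = |C_j(LʲηA′ − LʲηHD(A′))| ≦ C₂(Lʲη|A′| + B₀|D(A′)|)² ≦ 4C₂|A′|²₍₋₁₎. (55)  This implies that a power series expansion of D(A′) begins with
second order terms. … D^{(2)}(A′) = C_j^{(2)}(LʲηA′) …»; p. 290 [PDF 14]: «The expression ⟨HD(A′), J⟩ may be decomposed into terms of second and higher orders. Taking into account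
that the second order term D^{(2)}(A′) in the expansion of D(A′) is equal to C^{(2)}(A′) … we have ⟨HD(A′), J⟩ = ⟨HC^{(2)}(A′), J⟩ + ⟨HD₃(A′), J⟩. (78)» and «V(A′) = −⟨HD₃(A′), J⟩
− … (80)»; p. 291 (85): «−⟨H δD₃(A′)∕δA′, J⟩ = −Σ … 𝔇₂(A′; c₁, b)».  Cell GAPS G-adv2-29 (ii): [B13] p. 10 bounds `−⟨HD₃(A′), J⟩` citing (55), which is QUADRATIC — nothing printed
bounds `D₃` CUBICALLY; r08's located constant is `8C₂ε₃⁻¹`.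

THE READING.  Along the complex slice `f(τ) = (Dfun(τA′))(j,c)`, holomorphic on `|τ| < ε∕σ` for `A′` of weighted size `≤ σ` (p. 286 «an analytic function of A′»), (55) reads
`‖f(τ)‖ ≤ 4C₂σ²|τ|²`; its `τ²`-coefficient `a₂` IS `½D²Dfun(0)(A′, A′)(j,c)` (§1: power series at `0`, `a₂ = p.coeff 2 = f″(0)∕2!`, and `f″(0)` by the chain rule through
`fderiv ℂ Dfun`, holomorphic on the ball by `N07ChartDDecayAnalytic`), and the order-2 Schwarz step gives `‖a₂‖ ≤ 4C₂σ²` and `‖f(1) − a₂‖ ≤ 2·4C₂σ²·(σ∕ε) = 8C₂σ³∕ε`.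

WHAT IS PROVED (sorry-free; no definition; axioms standard).
§1 (abstract) `differentiableOn_slice`, `hasDerivAt_slice` (the slice of `Φ` itself along `τ ↦ τ•A`, read out by `π`), ★★★ `leadCoeff_two_slice_eq` (r08's
   `leadCoeff (τ ↦ π(Φ(τ•A))) 2 = ½·π(D²Φ(0)(A)(A))` for `Φ`, `DΦ` holomorphic on an open set containing the disc's segment), ★★ `norm_secondOrder_le` (`‖π(Φ(τ•A))‖ ≤ K|τ|²` on
   `|τ| < r`, `r > 0` ⇒ `‖½π(D²Φ(0)AA)‖ ≤ K`), ★★★ `norm_sub_secondOrder_le` (`r > 1` ⇒ `‖π(Φ A) − ½π(D²Φ(0)AA)‖ ≤ 2K∕r`).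
§2 ★★★★ `exists_chartD3_T4` — `N07ChartD2Remainder.exists_chartD2_T4` RE-EXPORTED VERBATIM (the same `(H, Dfun)` and all its conjuncts: (46) letter, `C^ω`, holomorphic `fderiv`,
   `fderiv ℂ Dfun 0 = 0`, per-point (55)∕(49)∕(48)∕`HasFDerivAt`∕(73) norm + kernel, the linear-term and 𝔇₂ bounds) ∧ for every `A′` of weighted size `≤ σ`: (`σ > 0`)
   **`‖(½·D²Dfun(0)(A′, A′))(j,c)‖ ≤ 4C₂σ²`** and (`0 < σ < ε`) **`‖(Dfun A′ − ½·D²Dfun(0)(A′, A′))(j,c)‖ ≤ 8C₂·σ³∕ε`** — ONE record package with `D = D^{(2)} + D₃`, `𝔇 = 𝔇^{(1)} + 𝔇₂`,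
   `𝔇^{(1)} = D²D(0)(A′, ·)`, all four sized (that `𝔇^{(1)} = δD^{(2)}∕δA′`, i.e. the symmetry of `D²D(0)`, is NOT typed here).

HONEST FRAMING: count-neutral helper; one-variable power-series ∕ Cauchy bookkeeping (Mathlib + r08's kernel-checked tool) on this seat's record package — NO new estimate of [15];
the cubic constant carries the window radius (`8C₂∕ε`, G-adv2-29's located reading); `D^{(2)} = C^{(2)}` ((56)), (58), the ∇-row, (85)–(86), [B13] (1.39) and [15] Sects. D–F NOT
here; stub 1 ∕ K0⁷ ∕ K1⁹ NOT closed; N07 NOT discharged; counts unmoved; one finite T⁴ programme at fixed ε — NOT continuum ∕ ℝ⁴ ∕ OS ∕ mass gap ∕ Clay: the Yang–Mills mass gap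
is NOT proved by any of this; R4 closes the conditional rung `BalabanLadder.UV` only.  No `sorry`, no `def`, no `instance`, no `notation`.

References: [15] T. Bałaban, CMP 102 (1985) 277–309 [Balaban1985Variational] ((55)–(56) p.286, (63) p.287, Prop. 3 + remark p.289, (78)∕(80) p.290, (85) p.291); [B13] CMP 116
(1988) 1–22 [Balaban1988LargeFieldRG] (p.10); [4] = [B7] CMP 98 (1985) 17–51 [Balaban1985Averaging] ((134)–(137) pp.38–39).
-/

noncomputable section

open scoped BigOperators Matrix.Norms.L2Operator ContDiff Topology
open NormedSpace Metric Set Filter Asymptotics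

namespace Summit.QuantumFields.YangMills.BalabanUVNodes.N07ChartD3Cubic

open Literature.MathematicalPhysics.QuantumFieldTheory.Balaban1983to89
open Literature.MathematicalPhysics.QuantumFieldTheory.Balaban1983to89.T4Continuum (T4Family)
open Literature.MathematicalPhysics.QuantumFieldTheory.Balaban1983to89.B11SchwarzRemainder (leadCoeff norm_sub_leadCoeff_le_of_pow_bound_two
  norm_leadCoeff_le_of_pow_bound)
open B6SectADomainsV1 (Domains)
open B6SectAOperatorsV1 (BondIdx)
open Summit.QuantumFields.YangMills.Theorems.FlatCubeOpsText (Adm22 distBI)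
open Summit.QuantumFields.YangMills.Theorems.K0FlatCubeOpsTextP (IsLevWeight levWeight_nonneg)
open Summit.QuantumFields.YangMills.Theorems.Prop8Chart (chartLog)
open Summit.QuantumFields.YangMills.Theorems.K0Stub1ChartDAnalytic (isOpen_weightedBall)
open Summit.QuantumFields.YangMills.BalabanUVNodes.N07ChartD2Remainder (hasDerivAt_slice_fderiv_zero exists_chartD2_T4)

/-! ## §1 The second Taylor coefficient of a slice and the cubic remainder (abstract) -/

section Abstract

variable {X Y E : Type*} [NormedAddCommGroup X] [NormedSpace ℂ X] [NormedAddCommGroup Y] [NormedSpace ℂ Y]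
  [NormedAddCommGroup E] [NormedSpace ℂ E]

/-- The slice `τ ↦ π(Φ(τ•A))` is holomorphic on every disc whose segment lies in the holomorphy domain `U` of `Φ` ([4] (137)'s device; p. 286 «an analytic function of A′»).
[cite: Balaban1985Variational, (55)-(56) p.286; Balaban1985Averaging, (137) p.39] -/
theorem differentiableOn_slice {Φ : X → Y} {U : Set X} (hΦ : DifferentiableOn ℂ Φ U) (A : X) (π : Y →L[ℂ] E) {r : ℝ}
    (hmaps : ∀ τ : ℂ, ‖τ‖ < r → τ • A ∈ U) :
    DifferentiableOn ℂ (fun τ : ℂ => π (Φ (τ • A))) (ball (0 : ℂ) r) := by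
  have h1 : DifferentiableOn ℂ (fun τ : ℂ => Φ (τ • A)) (ball (0 : ℂ) r) := by
    refine hΦ.comp (f := fun τ : ℂ => τ • A) (differentiableOn_id.smul_const A) ?_
    intro τ hτ
    exact hmaps τ (mem_ball_zero_iff.mp hτ)
  exact π.differentiable.comp_differentiableOn h1

/-- The derivative of the slice at a point `τ` of the segment: `π(DΦ(τ•A)A)` (chain rule; `U` open). [cite: Balaban1985Variational, (63) p.287] -/
theorem hasDerivAt_slice {Φ : X → Y} {U : Set X} (hU : IsOpen U) (hΦ : DifferentiableOn ℂ Φ U) (A : X) (π : Y →L[ℂ] E)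
    {τ : ℂ} (hτ : τ • A ∈ U) :
    HasDerivAt (fun s : ℂ => π (Φ (s • A))) (π (fderiv ℂ Φ (τ • A) A)) τ := by
  have hdiff : DifferentiableAt ℂ Φ (τ • A) := hΦ.differentiableAt (hU.mem_nhds hτ)
  have hline : HasDerivAt (fun s : ℂ => s • A) A τ := by
    simpa using (hasDerivAt_id τ).smul_const A
  have h1 : HasDerivAt (fun s : ℂ => Φ (s • A)) (fderiv ℂ Φ (τ • A) A) τ :=
    HasFDerivAt.comp_hasDerivAt_of_eq τ hdiff.hasFDerivAt hline rfl
  exact π.hasFDerivAt.comp_hasDerivAt τ h1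

variable [CompleteSpace E]

/-- ★★★ **THE SECOND TAYLOR COEFFICIENT OF THE SLICE IS `½π(D²Φ(0)(A, A))`.**  For `Φ` and `DΦ` holomorphic on an open `U` containing the segment `{τ•A : |τ| < r}` (`r > 0`),
r08's coefficient `leadCoeff (τ ↦ π(Φ(τ•A))) 2` (`= lim_{τ→0} τ⁻²·π(Φ(τ•A))` when the slice starts at order 2) equals `½·π(D²Φ(0)(A)(A))`: power series of the slice at `0`
(`a₂ = p.coeff 2 = f″(0)∕2!`) and `f″(0) = π(D²Φ(0)AA)` by the chain rule through `DΦ`.  This discharges the hook «`a₂ = D^{(2)}(Â′)`» of `B11SchwarzRemainder.reading_D3`.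
[cite: Balaban1985Variational, (55)-(56) p.286, (78) p.290] -/
theorem leadCoeff_two_slice_eq {Φ : X → Y} {U : Set X} (hU : IsOpen U) (hΦ : DifferentiableOn ℂ Φ U)
    (hd : DifferentiableOn ℂ (fderiv ℂ Φ) U) (A : X) (π : Y →L[ℂ] E) {r : ℝ} (hr : 0 < r)
    (hmaps : ∀ τ : ℂ, ‖τ‖ < r → τ • A ∈ U) :
    leadCoeff (fun τ : ℂ => π (Φ (τ • A))) 2 = (2 : ℂ)⁻¹ • π ((fderiv ℂ (fderiv ℂ Φ) 0 A) A) := by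
  have h0U : (0 : X) ∈ U := by simpa using hmaps 0 (by simpa using hr)
  set f : ℂ → E := fun τ => π (Φ (τ • A)) with hf
  have hfd : DifferentiableOn ℂ f (ball (0 : ℂ) r) := differentiableOn_slice hΦ A π hmaps
  have han : AnalyticAt ℂ f 0 := hfd.analyticAt (ball_mem_nhds (0 : ℂ) hr)
  obtain ⟨p, hp⟩ := han
  -- `leadCoeff f 2 = p.coeff 2`: the iterated divided slopes carry the shifted series
  have h1 : leadCoeff f 2 = p.coeff 2 := by
    have h := (hp.has_fpower_series_iterate_dslope_fslope 2).coeff_zero 1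
    have ht : leadCoeff f 2 = (Function.swap dslope (0 : ℂ))^[2] f 0 := rfl
    rw [ht, ← h]
    show (FormalMultilinearSeries.fslope^[2] p).coeff 0 = p.coeff 2
    simp only [Function.iterate_succ, Function.iterate_zero, Function.comp_apply, id_eq]
    rw [FormalMultilinearSeries.coeff_fslope, FormalMultilinearSeries.coeff_fslope]
  -- `p.coeff 2 = f″(0)∕2!` and `f″(0) = π(D²Φ(0)AA)`
  obtain ⟨r', hr'⟩ := hp
  have h2 : (Nat.factorial 2) • p 2 (fun _ => (1 : ℂ)) = iteratedFDeriv ℂ 2 f 0 (fun _ => 1) := hr'.factorial_smul 1 2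
  have h3 : p 2 (fun _ => (1 : ℂ)) = p.coeff 2 := by
    rw [FormalMultilinearSeries.apply_eq_pow_smul_coeff, one_pow, one_smul]
  have h4 : iteratedFDeriv ℂ 2 f 0 (fun _ => 1) = iteratedDeriv 2 f 0 := iteratedDeriv_eq_iteratedFDeriv.symm
  have h5 : iteratedDeriv 2 f 0 = deriv (deriv f) 0 := by
    rw [show (2 : ℕ) = 1 + 1 from rfl, iteratedDeriv_succ, iteratedDeriv_one]
  have h6 : deriv (deriv f) 0 = π ((fderiv ℂ (fderiv ℂ Φ) 0 A) A) := by
    have hev : deriv f =ᶠ[𝓝 (0 : ℂ)] (fun τ => π (fderiv ℂ Φ (τ • A) A)) := by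
      filter_upwards [ball_mem_nhds (0 : ℂ) hr] with τ hτ
      exact (hasDerivAt_slice hU hΦ A π (hmaps τ (mem_ball_zero_iff.mp hτ))).deriv
    rw [hev.deriv_eq]
    exact (hasDerivAt_slice_fderiv_zero hU h0U hd A A π).deriv
  rw [h1, ← h3]
  rw [Nat.factorial_two, h4, h5, h6] at h2
  rw [← h2, ← Nat.cast_smul_eq_nsmul ℂ, smul_smul]
  norm_num

/-- ★★ **THE SECOND-ORDER PART IS BOUNDED LIKE (55)**: `‖π(Φ(τ•A))‖ ≤ K|τ|²` on `|τ| < r` (`r > 0`, `K ≥ 0`) ⇒ `‖½π(D²Φ(0)AA)‖ ≤ K` (Cauchy's coefficient bound at order 2,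
r08's `norm_leadCoeff_le_of_pow_bound`, with §1's identification). [cite: Balaban1985Variational, (55)-(56) p.286; Balaban1985Averaging, (135)-(136) pp.38-39] -/
theorem norm_secondOrder_le {Φ : X → Y} {U : Set X} (hU : IsOpen U) (hΦ : DifferentiableOn ℂ Φ U)
    (hd : DifferentiableOn ℂ (fderiv ℂ Φ) U) (A : X) (π : Y →L[ℂ] E) {r K : ℝ} (hr : 0 < r) (hK : 0 ≤ K)
    (hmaps : ∀ τ : ℂ, ‖τ‖ < r → τ • A ∈ U) (hKb : ∀ τ : ℂ, ‖τ‖ < r → ‖π (Φ (τ • A))‖ ≤ K * ‖τ‖ ^ 2) :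
    ‖(2 : ℂ)⁻¹ • π ((fderiv ℂ (fderiv ℂ Φ) 0 A) A)‖ ≤ K := by
  have hfd : DifferentiableOn ℂ (fun τ : ℂ => π (Φ (τ • A))) (ball (0 : ℂ) r) := differentiableOn_slice hΦ A π hmaps
  have hKb' : ∀ t ∈ ball (0 : ℂ) r, ‖π (Φ (t • A))‖ ≤ K * ‖t‖ ^ 2 := fun t ht => hKb t (mem_ball_zero_iff.mp ht)
  have h := norm_leadCoeff_le_of_pow_bound hr hK hfd hKb'
  rwa [leadCoeff_two_slice_eq hU hΦ hd A π hr hmaps] at h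

/-- ★★★ **THE CUBIC REMAINDER `D₃ = D − D^{(2)}` (abstract form).**  `‖π(Φ(τ•A))‖ ≤ K|τ|²` on `|τ| < r` with `r > 1`, `K ≥ 0` ⇒ at the point itself
**`‖π(Φ A) − ½π(D²Φ(0)AA)‖ ≤ 2K∕r`** — r08's `norm_sub_leadCoeff_le_of_pow_bound_two` at `n = 2`, `τ = 1`, with §1's identification of `a₂` (cell GAPS G-adv2-29 (ii): the larger the
disc, the smaller the constant; at the chart radius the cubic constant is `8C₂ε₃⁻¹`). [cite: Balaban1985Variational, (55)-(56) p.286, (78)/(80) p.290] -/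
theorem norm_sub_secondOrder_le {Φ : X → Y} {U : Set X} (hU : IsOpen U) (hΦ : DifferentiableOn ℂ Φ U)
    (hd : DifferentiableOn ℂ (fderiv ℂ Φ) U) (A : X) (π : Y →L[ℂ] E) {r K : ℝ} (hr : 1 < r) (hK : 0 ≤ K)
    (hmaps : ∀ τ : ℂ, ‖τ‖ < r → τ • A ∈ U) (hKb : ∀ τ : ℂ, ‖τ‖ < r → ‖π (Φ (τ • A))‖ ≤ K * ‖τ‖ ^ 2) :
    ‖π (Φ A) - (2 : ℂ)⁻¹ • π ((fderiv ℂ (fderiv ℂ Φ) 0 A) A)‖ ≤ 2 * K * r⁻¹ := by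
  have hr0 : 0 < r := zero_lt_one.trans hr
  set f : ℂ → E := fun τ => π (Φ (τ • A)) with hf
  have hfd : DifferentiableOn ℂ f (ball (0 : ℂ) r) := differentiableOn_slice hΦ A π hmaps
  have hKb' : ∀ t ∈ ball (0 : ℂ) r, ‖f t‖ ≤ K * ‖t‖ ^ 2 := fun t ht => hKb t (mem_ball_zero_iff.mp ht)
  have hlc : leadCoeff f 2 = (2 : ℂ)⁻¹ • π ((fderiv ℂ (fderiv ℂ Φ) 0 A) A) := leadCoeff_two_slice_eq hU hΦ hd A π hr0 hmaps
  have h1mem : (1 : ℂ) ∈ ball (0 : ℂ) r := by simpa using hr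
  have h := norm_sub_leadCoeff_le_of_pow_bound_two hr0 hK hfd hKb' h1mem
  rw [hlc, one_pow, one_smul, norm_one, one_pow, mul_one] at h
  have hf1 : f 1 = π (Φ A) := by simp [hf]
  rw [hf1] at h
  exact h

end Abstract

/-! ## §2 At NODE 00's record: `D = D^{(2)} + D₃` with `|D^{(2)}| ≤ 4C₂σ²`, `|D₃| ≤ 8C₂σ³∕ε`, on the 𝔇₂ package -/

/-- ★★★★ **`D₃ := D − D^{(2)}` IS CUBIC AT NODE 00's RECORD, `D^{(2)}(A′) = ½D²D(0)(A′, A′)`.**  `N07ChartD2Remainder.exists_chartD2_T4` RE-EXPORTED VERBATIM — for every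
`F : T4Family`: thresholds `M_h⁰, R₀`, constants `C_K ≥ 0`, `δ₀ > 0`, `B₃ > 0`; for every admissible nested family `D` of top level `K − n` on NODE 00's torus, every level-weight family
`w`, every `ε > 0` in the window: the SAME `(H, Dfun)` with the (46) letter, `C^ω`, holomorphic `fderiv`, `fderiv ℂ Dfun 0 = 0`, per-point (55)∕(49)∕(48)∕`HasFDerivAt`∕(73) (norm +
kernel), the linear-term bounds and the 𝔇₂ bounds — AND IN ADDITION, for every `A′` of weighted size `≤ σ`: (`σ > 0`) **`‖(½·D²Dfun(0)(A′)(A′))(j,c)‖ ≤ 4C₂σ²`** (the second-order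
part `D^{(2)}` obeys (55)); (`0 < σ < ε`) **`‖(Dfun A′ − ½·D²Dfun(0)(A′)(A′))(j,c)‖ ≤ 8C₂·σ³∕ε`** (the order-`≥ 3` part `D₃` is cubic, G-adv2-29's constant with the window radius
`ε` for `ε₃`).  §1 on the slices `τ ↦ (Dfun(τ•A′))(j,c)`, `|τ| < ε∕σ`, with (55) read as `‖f(τ)‖ ≤ 4C₂σ²|τ|²`.
[cite: Balaban1985Variational, (55)-(56) p.286, (63) p.287, (73) + Prop. 3 + remark p.289, (78)/(80) p.290, (85)-(86) p.291; Balaban1985Averaging, (137) p.39] -/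
theorem exists_chartD3_T4 {ι : Type*} [Fintype ι] [DecidableEq ι] [Nonempty ι] (F : T4Family) :
    ∃ (Mh₀ R₀ : ℕ) (CK δ₀ B₃ : ℝ), 0 ≤ CK ∧ 0 < δ₀ ∧ 0 < B₃ ∧
    ∀ (n K : ℕ) (_ : 1 ≤ K - n) (_ : K - n + 1 ≤ F.m + K) {Mh R a' : ℕ} (_ : Mh = F.L ^ a') (_ : Mh₀ ≤ Mh) (_ : R₀ ≤ R) (_ : 2 * F.L ≤ R)
      (_ : a' + 3 ≤ F.m + n) (D : Domains (F.P K)) (_ : D.k = K - n) (_ : Adm22 D R (F.L * Mh))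
      (w : ℕ → PBond (F.P K) 0 → ℝ) (_ : IsLevWeight (F.P K) (K - n) D w) {ε : ℝ} (_ : 0 < ε)
      (_ : 18 * (960 * ((((F.P K).d + 2) * (F.P K).L : ℕ) : ℝ) * ((F.P K).L : ℝ) / (12800 * ((((F.P K).d + 2) * (F.P K).L : ℕ) : ℝ) ^ 2 * ((F.P K).L : ℝ))⁻¹) *
        (CK * B₃ * (1 + 2 * (((F.P K).d + 2) * (F.P K).L : ℕ)) * (1 + 2 * (((F.P K).d + 2) * (F.P K).L : ℕ) * (1 + (F.P K).L))) * ε ≤ 1)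
      (_ : 64 * ε ≤ (12800 * ((((F.P K).d + 2) * (F.P K).L : ℕ) : ℝ) ^ 2 * ((F.P K).L : ℝ))⁻¹),
      let η : ℝ := (((F.P K).L : ℝ)⁻¹) ^ (K - n)
      let Rs : ℝ := (12800 * ((((F.P K).d + 2) * (F.P K).L : ℕ) : ℝ) ^ 2 * ((F.P K).L : ℝ))⁻¹
      let C₂ : ℝ := 960 * ((((F.P K).d + 2) * (F.P K).L : ℕ) : ℝ) * ((F.P K).L : ℝ) / Rs
      let C₃ : ℝ := 3840 * ((((F.P K).d + 2) * (F.P K).L : ℕ) : ℝ) * ((F.P K).L : ℝ) / Rs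
      let Qlin := (fderiv ℂ (chartLog η D : (PBond (F.P K) 0 → Matrix ι ι ℂ) → BondIdx D → Matrix ι ι ℂ) 0)
      ∃ (H : (BondIdx D → Matrix ι ι ℂ) →ₗ[ℂ] (PBond (F.P K) 0 → Matrix ι ι ℂ)) (Dfun : (PBond (F.P K) 0 → Matrix ι ι ℂ) → (BondIdx D → Matrix ι ι ℂ)),
        (∀ X, Qlin (H X) = X) ∧
        (∀ (X : BondIdx D → Matrix ι ι ℂ) (t : ℝ), 0 ≤ t → (∀ i, ‖X i‖ ≤ t) → ∀ b,
          w 1 b * ‖H X b‖ ≤ CK * B₃ * (1 + 2 * (((F.P K).d + 2) * (F.P K).L : ℕ)) * (1 + 2 * (((F.P K).d + 2) * (F.P K).L : ℕ) * (1 + (F.P K).L)) * t) ∧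
        ContDiffOn ℂ ω Dfun {A' : PBond (F.P K) 0 → Matrix ι ι ℂ | ∀ b, w 1 b * ‖A' b‖ < ε} ∧
        DifferentiableOn ℂ (fderiv ℂ Dfun) {A' : PBond (F.P K) 0 → Matrix ι ι ℂ | ∀ b, w 1 b * ‖A' b‖ < ε} ∧
        fderiv ℂ Dfun 0 = 0 ∧
        (∀ A' : PBond (F.P K) 0 → Matrix ι ι ℂ, (∀ b, w 1 b * ‖A' b‖ < ε) →
          (∀ (ρ : ℝ), 0 ≤ ρ → (∀ b, w 1 b * ‖A' b‖ ≤ ρ) → ∀ i, ‖Dfun A' i‖ ≤ 4 * C₂ * ρ ^ 2) ∧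
          chartLog η D (A' - H (Dfun A')) - Qlin (A' - H (Dfun A')) = Dfun A' ∧
          chartLog η D (A' - H (Dfun A')) = Qlin A' ∧
          HasFDerivAt Dfun (fderiv ℂ Dfun A') A' ∧
          (∀ (W : PBond (F.P K) 0 → Matrix ι ι ℂ) (t : ℝ), 0 ≤ t → (∀ b, w 1 b * ‖W b‖ ≤ t) → ∀ i, ‖fderiv ℂ Dfun A' W i‖ ≤ 4 * C₃ * ε * t) ∧
          ∀ (b : PBond (F.P K) 0) (a : Matrix ι ι ℂ) (δ : ℝ), 0 ≤ δ → δ ≤ δ₀ / 2 →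
            4 * C₃ * Real.exp (δ * 3) *
                (CK * B₃ * (1 + 2 * (((F.P K).d + 2) * (F.P K).L : ℕ) * Real.exp (δ * 4)) *
                  (1 + 2 * (((F.P K).d + 2) * (F.P K).L : ℕ) * (1 + (F.P K).L) * Real.exp (δ * 1))) * ε ≤ 1 →
            ∀ i, ‖fderiv ℂ Dfun A' (Pi.single b a) i‖ ≤ 4 * C₃ * ε * Real.exp (δ * 2) * (w 1 b * ‖a‖) * Real.exp (-(δ * distBI D b i))) ∧
        (∀ σ : ℝ, 0 < σ → ∀ A' : PBond (F.P K) 0 → Matrix ι ι ℂ, (∀ b, w 1 b * ‖A' b‖ ≤ σ) →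
          ∀ (W : PBond (F.P K) 0 → Matrix ι ι ℂ) (t : ℝ), 0 ≤ t → (∀ b, w 1 b * ‖W b‖ ≤ t) → ∀ i,
            ‖(fderiv ℂ (fderiv ℂ Dfun) 0 A') W i‖ ≤ 4 * C₃ * σ * t) ∧
        (∀ σ : ℝ, 0 < σ → ∀ A' : PBond (F.P K) 0 → Matrix ι ι ℂ, (∀ b, w 1 b * ‖A' b‖ ≤ σ) →
          ∀ (b : PBond (F.P K) 0) (a : Matrix ι ι ℂ) (δ : ℝ), 0 ≤ δ → δ ≤ δ₀ / 2 →
            4 * C₃ * Real.exp (δ * 3) *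
                (CK * B₃ * (1 + 2 * (((F.P K).d + 2) * (F.P K).L : ℕ) * Real.exp (δ * 4)) *
                  (1 + 2 * (((F.P K).d + 2) * (F.P K).L : ℕ) * (1 + (F.P K).L) * Real.exp (δ * 1))) * ε ≤ 1 →
            ∀ i, ‖(fderiv ℂ (fderiv ℂ Dfun) 0 A') (Pi.single b a) i‖ ≤
              4 * C₃ * σ * Real.exp (δ * 2) * (w 1 b * ‖a‖) * Real.exp (-(δ * distBI D b i))) ∧
        (∀ σ : ℝ, 0 < σ → σ < ε → ∀ A' : PBond (F.P K) 0 → Matrix ι ι ℂ, (∀ b, w 1 b * ‖A' b‖ ≤ σ) →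
          ∀ (W : PBond (F.P K) 0 → Matrix ι ι ℂ) (t : ℝ), 0 ≤ t → (∀ b, w 1 b * ‖W b‖ ≤ t) → ∀ i,
            ‖(fderiv ℂ Dfun A' - fderiv ℂ (fderiv ℂ Dfun) 0 A') W i‖ ≤ 8 * C₃ * (σ ^ 2 / ε) * t) ∧
        (∀ σ : ℝ, 0 < σ → σ < ε → ∀ A' : PBond (F.P K) 0 → Matrix ι ι ℂ, (∀ b, w 1 b * ‖A' b‖ ≤ σ) →
          ∀ (b : PBond (F.P K) 0) (a : Matrix ι ι ℂ) (δ : ℝ), 0 ≤ δ → δ ≤ δ₀ / 2 →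
            4 * C₃ * Real.exp (δ * 3) *
                (CK * B₃ * (1 + 2 * (((F.P K).d + 2) * (F.P K).L : ℕ) * Real.exp (δ * 4)) *
                  (1 + 2 * (((F.P K).d + 2) * (F.P K).L : ℕ) * (1 + (F.P K).L) * Real.exp (δ * 1))) * ε ≤ 1 →
            ∀ i, ‖(fderiv ℂ Dfun A' - fderiv ℂ (fderiv ℂ Dfun) 0 A') (Pi.single b a) i‖ ≤
              8 * C₃ * Real.exp (δ * 2) * (σ ^ 2 / ε) * (w 1 b * ‖a‖) * Real.exp (-(δ * distBI D b i))) ∧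
        (∀ σ : ℝ, 0 < σ → ∀ A' : PBond (F.P K) 0 → Matrix ι ι ℂ, (∀ b, w 1 b * ‖A' b‖ ≤ σ) → ∀ i,
            ‖(2 : ℂ)⁻¹ • ((fderiv ℂ (fderiv ℂ Dfun) 0 A') A') i‖ ≤ 4 * C₂ * σ ^ 2) ∧
        (∀ σ : ℝ, 0 < σ → σ < ε → ∀ A' : PBond (F.P K) 0 → Matrix ι ι ℂ, (∀ b, w 1 b * ‖A' b‖ ≤ σ) → ∀ i,
            ‖Dfun A' i - (2 : ℂ)⁻¹ • ((fderiv ℂ (fderiv ℂ Dfun) 0 A') A') i‖ ≤ 8 * C₂ * (σ ^ 3 / ε)) := by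
  classical
  obtain ⟨Mh₀, R₀, CK, δ₀, B₃, hCK, hδ₀, hB₃, hmain⟩ := exists_chartD2_T4 (ι := ι) F
  refine ⟨Mh₀, R₀, CK, δ₀, B₃, hCK, hδ₀, hB₃, ?_⟩
  intro n K hk1 hk' Mh R a' hMha hMh hR h2L hsize D hDk hAdm w hw ε hε h18 h2 η Rs C₂ C₃ Qlin
  obtain ⟨H, Dfun, hHinv, hsup, hω, hfd, h0, hpt, hlinN, hlinK, h2N, h2K⟩ :=
    hmain n K hk1 hk' hMha hMh hR h2L hsize D hDk hAdm w hw hε h18 h2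
  have hC₂ : 0 ≤ C₂ := by
    show 0 ≤ 960 * ((((F.P K).d + 2) * (F.P K).L : ℕ) : ℝ) * ((F.P K).L : ℝ) / Rs; positivity
  have hU : IsOpen {A' : PBond (F.P K) 0 → Matrix ι ι ℂ | ∀ b, w 1 b * ‖A' b‖ < ε} := isOpen_weightedBall w ε
  have hdiff : DifferentiableOn ℂ Dfun {A' : PBond (F.P K) 0 → Matrix ι ι ℂ | ∀ b, w 1 b * ‖A' b‖ < ε} := hω.differentiableOn (by simp)
  -- the complex line through a point of weighted size `≤ σ` stays in the ball for `|τ| < ε∕σ`, with size `≤ |τ|σ`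
  have hsizeτ : ∀ (σ : ℝ) (A' : PBond (F.P K) 0 → Matrix ι ι ℂ), (∀ b, w 1 b * ‖A' b‖ ≤ σ) →
      ∀ (τ : ℂ) (b : PBond (F.P K) 0), w 1 b * ‖(τ • A') b‖ ≤ ‖τ‖ * σ := by
    intro σ A' hA' τ b
    rw [Pi.smul_apply, norm_smul, mul_left_comm]
    exact mul_le_mul_of_nonneg_left (hA' b) (norm_nonneg τ)
  have hline : ∀ (σ : ℝ), 0 < σ → ∀ A' : PBond (F.P K) 0 → Matrix ι ι ℂ, (∀ b, w 1 b * ‖A' b‖ ≤ σ) →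
      ∀ τ : ℂ, ‖τ‖ < ε / σ → (τ • A') ∈ {A' : PBond (F.P K) 0 → Matrix ι ι ℂ | ∀ b, w 1 b * ‖A' b‖ < ε} := by
    intro σ hσ A' hA' τ hτ b
    have h2' : ‖τ‖ * σ < ε := by rwa [lt_div_iff₀ hσ] at hτ
    exact (hsizeτ σ A' hA' τ b).trans_lt h2'
  -- (55) read on the slice: `‖Dfun(τ•A′)(j,c)‖ ≤ 4C₂σ²·|τ|²`
  have h55τ : ∀ (σ : ℝ), 0 < σ → ∀ A' : PBond (F.P K) 0 → Matrix ι ι ℂ, (∀ b, w 1 b * ‖A' b‖ ≤ σ) → ∀ (i : BondIdx D) (τ : ℂ), ‖τ‖ < ε / σ →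
      ‖(ContinuousLinearMap.proj (R := ℂ) i) (Dfun (τ • A'))‖ ≤ 4 * C₂ * σ ^ 2 * ‖τ‖ ^ 2 := by
    intro σ hσ A' hA' i τ hτ
    have h := (hpt (τ • A') (hline σ hσ A' hA' τ hτ)).1 (‖τ‖ * σ) (by positivity) (hsizeτ σ A' hA' τ) i
    have heq : 4 * C₂ * (‖τ‖ * σ) ^ 2 = 4 * C₂ * σ ^ 2 * ‖τ‖ ^ 2 := by ring
    rw [ContinuousLinearMap.proj_apply, ← heq]
    exact h
  refine ⟨H, Dfun, hHinv, hsup, hω, hfd, h0, hpt, hlinN, hlinK, h2N, h2K, ?_, ?_⟩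
  · -- `|D^{(2)}| ≤ 4C₂σ²`
    intro σ hσ A' hA' i
    have hr : 0 < ε / σ := div_pos hε hσ
    have h := norm_secondOrder_le hU hdiff hfd A' (ContinuousLinearMap.proj (R := ℂ) i) hr (by positivity : (0 : ℝ) ≤ 4 * C₂ * σ ^ 2)
      (hline σ hσ A' hA') (h55τ σ hσ A' hA' i)
    exact h
  · -- `|D₃| ≤ 8C₂σ³∕ε`
    intro σ hσ hσε A' hA' i
    have hr : 1 < ε / σ := by rwa [lt_div_iff₀ hσ, one_mul]
    have h := norm_sub_secondOrder_le hU hdiff hfd A' (ContinuousLinearMap.proj (R := ℂ) i) hr (by positivity : (0 : ℝ) ≤ 4 * C₂ * σ ^ 2)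
      (hline σ hσ A' hA') (h55τ σ hσ A' hA' i)
    have h' : ‖Dfun A' i - (2 : ℂ)⁻¹ • ((fderiv ℂ (fderiv ℂ Dfun) 0 A') A') i‖ ≤ 2 * (4 * C₂ * σ ^ 2) * (ε / σ)⁻¹ := h
    have hεne : ε ≠ 0 := hε.ne'
    have hσne : σ ≠ 0 := hσ.ne'
    have heq : 2 * (4 * C₂ * σ ^ 2) * (ε / σ)⁻¹ = 8 * C₂ * (σ ^ 3 / ε) := by
      field_simp
      ring
    rw [← heq]
    exact h'

end Summit.QuantumFields.YangMills.BalabanUVNodes.N07ChartD3Cubic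

end
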